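import Summits.CriticalPhenomena.Ising3DConformalLimit.Theorems.RotationUpgradeFromTwoPoint.Negative.AutomaticOrders
import Summits.CriticalPhenomena.Ising3DConformalLimit.Theorems.HyperoctahedralRPLimitRotationInvariantLimitRegularity
import Summits.CriticalPhenomena.Ising3DConformalLimit.Theorems.HyperoctahedralRPLimitRotationInvariantInPlaneLightCone
import Literature.MathematicalPhysics.QuantumFieldTheory.MirrorStencilCauchySchwarz
import Literature.Analysis.FluidPDE.NewtonKernel
import Literature.Analysis.FluidPDE.SecondDifferenceLaplacian
import Literature.Analysis.FluidPDE.HarmonicOfSmallStencil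
import HarnessLib

/-!
# Crux `GaussianScaleMixture.RotationUpgradeFromTwoPoint` (stmt-CriticalPhenomena-8367), line
# `null-laplacian-edge-gaussianity`: STUB 2 `stub_exteriorHarmonic` — the lever at the edge `Δ = 1/2`

Under the crux hypotheses (H1)–(H7), nine-mirror Osterwalder–Schrader positivity of all orders
and `Δ = 1/2`, for every injective cluster `y`, every lattice normal `n ∈ {eᵢ, eᵢ ± eⱼ}` and
every `u` separated from `y` by the mirror family of `n`, the function `x ↦ S_{m+1}(x, y)` is
harmonic at `u` (`InnerProductSpace.HarmonicAt`).

## Proof (discrete OS null vector; no field operators, no sphere averages, no Riemann sums)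

* `stub_limitRegularity` (landed, line `quarter-turn-liouville` of crux stmt-1980) turns (H1)–(H6)
  into `LimitRegularity` (hyperoctahedral invariance, permutation symmetry, continuity off the
  diagonals, Gaussian domination); with the RP hypothesis this is `LimitStructure`, whence mirror
  OS data `MirrorOSData S (c • n)` for every lattice normal and `c ≠ 0`
  (`mirrorOSData_smul_latticeNormal`); the case "`y` below `u`" is the case "`y` above `u`" for `-n`.
* Translating along `n` (translation invariance) puts the mirror `n^⊥` strictly between `u` and
  `y`; it remains to show that `f = S_{m+1}(·, y)` is harmonic on the open half-space
  `{⟪x, n⟫ < 0}` when `y ⊂ {⟪·, n⟫ > 0}` (`harmonicOnNhd_of_mirrorOSData`).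
* In the OS Hilbert space of the mirror (tree `MirrorOSData.Space`, kernel vectors `δ_a` with
  `⟪δ_a, δ_b⟫ = S(θa ⊔ b)`), the one-point vectors `δ_{θp}`, `p` below the mirror, have Gram kernel
  `S₂(p, θp') = A‖p - θp'‖⁻¹ = κ(p - θp')` at `Δ = 1/2` (`two_point_law`), with `κ` HARMONIC off a
  small ball (a multiple of the tree's `newtonFar`), and `⟪δ_{θp}, δ_y⟫ = f(p)`. The `7`-point
  stencil vector `V = Σᵢ (δ_{θ(x+heᵢ)} + δ_{θ(x-heᵢ)} - 2δ_{θx})` therefore has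
  `⟪V, δ_y⟫ = (stencil of f)(x)` and `‖V‖² = (double stencil of κ)(x - θx)` (frames `e` and `θe`),
  which is `o(h⁴)` uniformly on compacts (`abs_double_stencil_le_of_laplacian_eq_zero`, tree file
  `SecondDifferenceLaplacian`: mean value theorem twice, `Δκ = 0`, uniform continuity of fourth
  derivatives — no harmonicity of derivatives of `κ`). Cauchy–Schwarz (`MirrorOSData.stencil_sq_le`,
  tree file `MirrorStencilCauchySchwarz`) makes the
  stencil of `f` an `o(h²)` uniformly on compacts, and `harmonicOnNhd_of_abs_stencil_le` (tree file
  `HarmonicOfSmallStencil`: summation by parts against test functions, Weyl's lemma on balls,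
  continuity) gives harmonicity.

The RP cubic decoy `cubicFamily (1/2)` of the Disproof fails the conclusion precisely because it is
not reflection positive: the proof uses the RP hypothesis (through `MirrorOSData.Space`).

## References
* J. Glimm, A. Jaffe, *Quantum Physics* (2nd ed. 1987), §6.1, Prop. 6.1.1. [GlimmJaffe1987]
* J. Fröhlich, R. Israel, E. H. Lieb, B. Simon, Comm. Math. Phys. 62 (1978), §2–3. [FrohlichIsraelLiebSimon1978]
* H. Weyl, Duke Math. J. 7 (1940), Lemma 2.
-/

noncomputable section

namespace Summit.CriticalPhenomena.Ising3DConformalLimit.Cruxes.RotationUpgradeFromTwoPoint.NullLaplacianEdgeGaussianity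

open scoped InnerProductSpace Topology
open Filter Set Metric
open Literature.Probability.LatticeModels Literature.MathematicalPhysics.QuantumFieldTheory
open Literature.Analysis.FluidPDE
open Summit.CriticalPhenomena.Ising3DConformalLimit.RotationUpgradeFromTwoPointNegative (two_point_law)
open Summit.CriticalPhenomena.Ising3DConformalLimit.Cruxes.LimitRotationInvariant.QuarterTurnLiouville
  (stub_limitRegularity mirrorOSData_smul_latticeNormal mirrorOSData_latticeNormal LimitStructure)

/-- Local notation for physical space `ℝ³ = EuclideanSpace ℝ (Fin 3)`. -/
local notation "E³" => EuclideanSpace ℝ (Fin 3)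

section Core

open scoped Laplacian

/-! ### The core: harmonicity on the far side of a mirror with OS data -/

/-- **Core of the lever.** Let `S` be translation invariant, scale covariant with `Δ = 1/2`, with
round two-point function and each `S_k` continuous off the diagonals, and let `S` carry mirror OS
data for the normal `n` (reflection positivity over half-space clusters in `{⟪·, n⟫ > 0}`,
`θ_n`-invariance, permutation symmetry). Then for every injective cluster `y` in `{⟪·, n⟫ > 0}`
the function `x ↦ S_{m+1}(x, y)` is harmonic on the open half-space `{⟪x, n⟫ < 0}`.
Proof (discrete OS null vector): at `Δ = 1/2` the Gram kernel of one-point clusters is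
`K(δ_{θp}, δ_{θp'}) = S₂(p, θp') = A‖p - θp'‖⁻¹ = κ(p - θp')` with `κ` HARMONIC off a small ball, so
by `MirrorOSData.stencil_sq_le` the square of the `7`-point stencil of `x ↦ S_{m+1}(x, y)` is at most the double
stencil of `κ` at `x - θx` (`abs_double_stencil_le_of_laplacian_eq_zero`: `o(h⁴)` uniformly on
compacts) times `S_{2m}(θy ⊔ y)`; hence the stencil is `o(h²)` and
`harmonicOnNhd_of_abs_stencil_le` (summation by parts + Weyl's lemma) concludes.
[cite: GlimmJaffe1987, §6.1 Prop. 6.1.1] -/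
theorem harmonicOnNhd_of_mirrorOSData {S : CorrFamily 3} (htr : IsTranslationInvariant S)
    (hsc : IsScaleCovariant (1 / 2) S)
    (hiso : ∀ (R : E³ ≃ₗᵢ[ℝ] E³) (x : E³), x ≠ 0 → S 2 ![0, R x] = S 2 ![0, x])
    (hcont : ∀ k, ContinuousOn (S k) (NonCoincident 3 k)) {n : E³} (hOS : MirrorOSData S n)
    {m : ℕ} {y : Fin m → E³} (hy : Function.Injective y) (hyn : ∀ i, 0 < ⟪y i, n⟫_ℝ) :
    InnerProductSpace.HarmonicOnNhd (fun x : E³ => S (m + 1) (Fin.cons x y))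
      {x | ⟪x, n⟫_ℝ < 0} := by
  set θ := (ℝ ∙ n)ᗮ.reflection with hθ
  obtain ⟨f, hf⟩ : ∃ f : E³ → ℝ, ∀ x, f x = S (m + 1) (Fin.cons x y) := ⟨_, fun _ => rfl⟩
  rw [show (fun x : E³ => S (m + 1) (Fin.cons x y)) = f from funext fun x => (hf x).symm]
  set V : Set E³ := {x | ⟪x, n⟫_ℝ < 0} with hVdef
  have hVo : IsOpen V := isOpen_lt (continuous_id.inner continuous_const) continuous_const
  have hn : n ≠ 0 := hOS.normal_ne_zero
  have hnpos : 0 < ‖n‖ := norm_pos_iff.2 hn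
  -- continuity of `f` on `V`
  have hfc : ContinuousOn f V := by
    intro x hx
    have hinj : Function.Injective (Fin.cons x y : Fin (m + 1) → E³) := by
      refine Fin.cons_injective_iff.2 ⟨?_, hy⟩
      rintro ⟨i, hi⟩
      have h1 := hyn i
      rw [hi] at h1
      exact lt_asymm h1 hx
    have hca : ContinuousAt (S (m + 1)) (Fin.cons x y) :=
      (hcont (m + 1)).continuousAt ((isOpen_nonCoincident 3 (m + 1)).mem_nhds hinj)
    have hcm : Continuous fun x : E³ => (Fin.cons x y : Fin (m + 1) → E³) :=
      Continuous.finCons (A := fun _ => E³) continuous_id continuous_const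
    have := ContinuousAt.comp (f := fun x : E³ => (Fin.cons x y : Fin (m + 1) → E³)) (x := x)
      hca hcm.continuousAt
    rw [show f = (S (m + 1)) ∘ (fun x : E³ => (Fin.cons x y : Fin (m + 1) → E³)) from
      funext fun x => hf x]
    exact this.continuousWithinAt
  -- the cluster `Y` and the two-point law at `Δ = 1/2`
  set Y : HalfSpaceCluster 3 n := ⟨m, y, hyn⟩ with hY
  set N : ℝ := mirrorKernel S n Y Y with hN
  have hN0 : 0 ≤ N := by
    have := hOS.sum_sum_nonneg {Y} (fun _ => 1)
    simpa using this
  set A : ℝ := S 2 ![0, Literature.Barriers.CriticalPhenomena.ScaleNotMoebius.axisUnit] with hA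
  have h2pt : ∀ a b : E³, a ≠ b → S 2 ![a, b] = A * ‖a - b‖⁻¹ := by
    intro a b hab
    rw [two_point_law htr hsc hiso hab, show (-(2 * (1 / 2 : ℝ))) = -1 by norm_num,
      Real.rpow_neg_one, mul_comm]
  -- frames
  set e : OrthonormalBasis (Fin 3) ℝ E³ := EuclideanSpace.basisFun (Fin 3) ℝ with he
  set e' : OrthonormalBasis (Fin 3) ℝ E³ := e.map θ with he'
  refine harmonicOnNhd_of_abs_stencil_le e hVo hfc fun K hKV hK ε hε => ?_
  rcases K.eq_empty_or_nonempty with hKe | hKne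
  · exact ⟨1, one_pos, fun x hx => by simp [hKe] at hx⟩
  -- uniform negativity `⟪x, n⟫ ≤ -η` on `K`
  obtain ⟨x₀, hx₀K, hmax⟩ := hK.exists_isMaxOn hKne (f := fun x : E³ => ⟪x, n⟫_ℝ)
    (continuous_id.inner continuous_const).continuousOn
  set η : ℝ := -⟪x₀, n⟫_ℝ with hη
  have hη0 : 0 < η := by have h0 : ⟪x₀, n⟫_ℝ < 0 := hKV hx₀K; linarith
  have hKη : ∀ x ∈ K, ⟪x, n⟫_ℝ ≤ -η := fun x hx => by
    have h0 : ⟪x, n⟫_ℝ ≤ ⟪x₀, n⟫_ℝ := hmax hx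
    linarith
  -- the harmonic kernel `κ = A/|z|` off a small ball
  set r₁ : ℝ := η / (2 * ‖n‖) with hr₁
  have hr₁0 : 0 < r₁ := by positivity
  have hr₁η : r₁ * ‖n‖ = η / 2 := by rw [hr₁]; field_simp
  set κ : E³ → ℝ := fun z => (-(4 * Real.pi) * A) * newtonFar (r₁ / 2) r₁ z with hκ
  have hNF2 : ContDiff ℝ 2 (newtonFar (r₁ / 2) r₁) :=
    contDiff_newtonFar (half_pos hr₁0) (half_lt_self hr₁0)
  have hκ4 : ContDiff ℝ 4 κ :=
    contDiff_const.mul (contDiff_newtonFar (half_pos hr₁0) (half_lt_self hr₁0))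
  have hUo : IsOpen {z : E³ | r₁ < ‖z‖} := isOpen_lt continuous_const continuous_norm
  have hκΔ : ∀ z ∈ {z : E³ | r₁ < ‖z‖}, (Δ κ) z = 0 := by
    intro z hz
    have hsm : κ = (-(4 * Real.pi) * A) • newtonFar (r₁ / 2) r₁ := by
      funext z; simp only [hκ, Pi.smul_apply, smul_eq_mul]
    rw [hsm, InnerProductSpace.laplacian_smul _ hNF2.contDiffAt, smul_eq_mul]
    have h0 := newtonFarLaplacian_eq_zero_of_gt (half_pos hr₁0).le (half_lt_self hr₁0) hz
    rw [newtonFarLaplacian] at h0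
    rw [h0, mul_zero]
  have hκeq : ∀ z : E³, r₁ ≤ ‖z‖ → κ z = A * ‖z‖⁻¹ := by
    intro z hz
    simp only [hκ]
    rw [newtonFar_eq_newtonKernel (half_pos hr₁0).le (half_lt_self hr₁0) hz, newtonKernel_eq]
    have hz0 : ‖z‖ ≠ 0 := (hr₁0.trans_le hz).ne'
    have hpi : Real.pi ≠ 0 := Real.pi_ne_zero
    field_simp
  -- separation of points below the mirror from reflected ones
  have hsep : ∀ p p' : E³, ⟪p, n⟫_ℝ ≤ -(η / 2) → ⟪p', n⟫_ℝ ≤ -(η / 2) → 2 * r₁ ≤ ‖p - θ p'‖ := by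
    intro p p' hp hp'
    have h := heights_div_norm_le_norm_reflection_sub hn (x := -p') (y := -p) (v := 0)
      (by rw [inner_neg_left]; linarith) (by rw [inner_neg_left]; linarith) (by simp)
    rw [add_zero, map_neg, inner_neg_left, inner_neg_left] at h
    have e1 : -θ p' - -p = p - θ p' := by abel
    rw [e1] at h
    refine le_trans ?_ h
    rw [le_div_iff₀ hnpos]
    nlinarith [hr₁η]
  set K' : Set E³ := (fun x => x - θ x) '' K with hK'
  have hK'c : IsCompact K' := hK.image (continuous_id.sub θ.continuous)
  have hK'U : K' ⊆ {z : E³ | r₁ < ‖z‖} := by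
    rintro _ ⟨x, hx, rfl⟩
    have := hsep x x (by linarith [hKη x hx]) (by linarith [hKη x hx])
    show r₁ < ‖x - θ x‖
    linarith
  -- the double stencil of `κ` is `o(h⁴)` on `K'`
  set ε' : ℝ := ε ^ 2 / (N + 1) with hε'
  have hε'0 : 0 < ε' := by positivity
  obtain ⟨h₀, hh₀, hdbl⟩ := abs_double_stencil_le_of_laplacian_eq_zero e e' hκ4 hUo hκΔ hK'c hK'U
    (fun h q => ∑ j, (κ (q + h • e j) + κ (q - h • e j) - 2 * κ q)) (fun _ _ => rfl) hε'0
  refine ⟨min h₀ r₁, lt_min hh₀ hr₁0, fun x hx h hh hhm => ?_⟩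
  have hhh₀ : h < h₀ := hhm.trans_le (min_le_left _ _)
  have hhr₁ : h < r₁ := hhm.trans_le (min_le_right _ _)
  -- the stencil points stay at height `≤ -η/2`
  have hpt : ∀ s : E³, ‖s‖ ≤ h → ⟪x + s, n⟫_ℝ ≤ -(η / 2) := by
    intro s hs
    rw [inner_add_left]
    have h1 : ⟪s, n⟫_ℝ ≤ ‖s‖ * ‖n‖ := real_inner_le_norm _ _
    have h2 : ‖s‖ * ‖n‖ ≤ h * ‖n‖ := mul_le_mul_of_nonneg_right hs hnpos.le
    have h3 : h * ‖n‖ ≤ η / 2 := by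
      rw [← hr₁η]; exact mul_le_mul_of_nonneg_right hhr₁.le hnpos.le
    linarith [hKη x hx]
  have hpos : ∀ s : E³, ‖s‖ ≤ h → 0 < ⟪θ (x + s), n⟫_ℝ := fun s hs => by
    rw [hθ, inner_mirrorReflection_normal]; linarith [hpt s hs]
  have hn1 : ∀ i, ‖h • e i‖ ≤ h := fun i => by
    rw [norm_smul, e.orthonormal.1 i, mul_one, Real.norm_eq_abs, abs_of_pos hh]
  have hn1' : ∀ i, ‖-(h • e i)‖ ≤ h := fun i => by rw [norm_neg]; exact hn1 i
  have h00 : ‖(0 : E³)‖ ≤ h := by rw [norm_zero]; exact hh.le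
  -- the clusters of the stencil (reflected into the positive half-space)
  set P : Fin 3 → HalfSpaceCluster 3 n := fun i =>
    ⟨1, fun _ => θ (x + h • e i), fun _ => hpos _ (hn1 i)⟩ with hP
  set Q : Fin 3 → HalfSpaceCluster 3 n := fun i =>
    ⟨1, fun _ => θ (x + -(h • e i)), fun _ => hpos _ (hn1' i)⟩ with hQ
  set C : HalfSpaceCluster 3 n := ⟨1, fun _ => θ (x + 0), fun _ => hpos 0 h00⟩ with hC
  have hcs := hOS.stencil_sq_le P Q C Y
  -- Gram entries against `Y` are values of `f`
  have hKY : ∀ (s : E³) (hs : ‖s‖ ≤ h),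
      mirrorKernel S n ⟨1, fun _ => θ (x + s), fun _ => hpos s hs⟩ Y = f (x + s) := by
    intro s hs
    show S (1 + m) (Fin.append (fun _ : Fin 1 => θ (θ (x + s))) y) = f (x + s)
    rw [hθ, Submodule.reflection_reflection, hf]
    exact corrFamily_append_singleton S (x + s) y
  -- Gram entries between one-point clusters are values of `κ`
  have hKK : ∀ (s s' : E³) (hs : ‖s‖ ≤ h) (hs' : ‖s'‖ ≤ h),
      mirrorKernel S n ⟨1, fun _ => θ (x + s), fun _ => hpos s hs⟩
        ⟨1, fun _ => θ (x + s'), fun _ => hpos s' hs'⟩ = κ ((x - θ x - θ s') + s) := by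
    intro s s' hs hs'
    show S (1 + 1) (Fin.append (fun _ : Fin 1 => θ (θ (x + s))) (fun _ : Fin 1 => θ (x + s'))) = _
    rw [corrFamily_append_one_one S]
    have hd : 2 * r₁ ≤ ‖(x + s) - θ (x + s')‖ := hsep _ _ (hpt s hs) (hpt s' hs')
    have hne : x + s ≠ θ (x + s') := fun h' => by
      rw [h', sub_self, norm_zero] at hd; linarith
    have harg : x - θ x - θ s' + s = (x + s) - θ (x + s') := by rw [map_add]; abel
    rw [hθ, Submodule.reflection_reflection, ← hθ, h2pt _ _ hne, harg,
      hκeq ((x + s) - θ (x + s')) (by linarith)]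
  -- the left-hand side of `hcs` is the stencil of `f` at `x`
  have lhs_eq : ∑ i, (mirrorKernel S n (P i) Y + mirrorKernel S n (Q i) Y -
      2 * mirrorKernel S n C Y) = ∑ i, (f (x + h • e i) + f (x - h • e i) - 2 * f x) := by
    refine Finset.sum_congr rfl fun i _ => ?_
    rw [hP, hQ, hC]
    simp only
    rw [hKY (h • e i) (hn1 i), hKY (-(h • e i)) (hn1' i), hKY 0 h00, add_zero, ← sub_eq_add_neg]
  -- the first factor of the right-hand side of `hcs` is the double stencil of `κ` at `x - θ x`
  have rhs_eq : (∑ i', ((∑ i, (mirrorKernel S n (P i) (P i') + mirrorKernel S n (Q i) (P i') -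
                  2 * mirrorKernel S n C (P i'))) +
              (∑ i, (mirrorKernel S n (P i) (Q i') + mirrorKernel S n (Q i) (Q i') -
                  2 * mirrorKernel S n C (Q i'))) -
              2 * (∑ i, (mirrorKernel S n (P i) C + mirrorKernel S n (Q i) C -
                  2 * mirrorKernel S n C C)))) =
      ∑ i', ((∑ j, (κ ((x - θ x + h • e' i') + h • e j) + κ ((x - θ x + h • e' i') - h • e j) -
                2 * κ (x - θ x + h • e' i'))) +
             (∑ j, (κ ((x - θ x - h • e' i') + h • e j) + κ ((x - θ x - h • e' i') - h • e j) -
                2 * κ (x - θ x - h • e' i'))) -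
             2 * (∑ j, (κ ((x - θ x) + h • e j) + κ ((x - θ x) - h • e j) - 2 * κ (x - θ x)))) := by
    refine Finset.sum_congr rfl fun i' _ => ?_
    have e'i : e' i' = θ (e i') := by rw [he', OrthonormalBasis.map_apply]
    have A1 : ∑ i, (mirrorKernel S n (P i) (P i') + mirrorKernel S n (Q i) (P i') -
        2 * mirrorKernel S n C (P i')) =
        ∑ j, (κ ((x - θ x - h • e' i') + h • e j) + κ ((x - θ x - h • e' i') - h • e j) -
          2 * κ (x - θ x - h • e' i')) := by
      refine Finset.sum_congr rfl fun i _ => ?_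
      rw [hP, hQ, hC]
      simp only
      rw [hKK (h • e i) (h • e i') (hn1 i) (hn1 i'), hKK (-(h • e i)) (h • e i') (hn1' i) (hn1 i'),
        hKK 0 (h • e i') h00 (hn1 i'), map_smul, ← e'i, add_zero, ← sub_eq_add_neg]
    have A2 : ∑ i, (mirrorKernel S n (P i) (Q i') + mirrorKernel S n (Q i) (Q i') -
        2 * mirrorKernel S n C (Q i')) =
        ∑ j, (κ ((x - θ x + h • e' i') + h • e j) + κ ((x - θ x + h • e' i') - h • e j) -
          2 * κ (x - θ x + h • e' i')) := by
      refine Finset.sum_congr rfl fun i _ => ?_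
      rw [hP, hQ, hC]
      simp only
      rw [hKK (h • e i) (-(h • e i')) (hn1 i) (hn1' i'),
        hKK (-(h • e i)) (-(h • e i')) (hn1' i) (hn1' i'),
        hKK 0 (-(h • e i')) h00 (hn1' i'), map_neg, map_smul, ← e'i, sub_neg_eq_add, add_zero,
        ← sub_eq_add_neg]
    have A3 : ∑ i, (mirrorKernel S n (P i) C + mirrorKernel S n (Q i) C -
        2 * mirrorKernel S n C C) =
        ∑ j, (κ ((x - θ x) + h • e j) + κ ((x - θ x) - h • e j) - 2 * κ (x - θ x)) := by
      refine Finset.sum_congr rfl fun i _ => ?_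
      rw [hP, hQ, hC]
      simp only
      rw [hKK (h • e i) 0 (hn1 i) h00, hKK (-(h • e i)) 0 (hn1' i) h00, hKK 0 0 h00 h00, map_zero,
        sub_zero, add_zero, ← sub_eq_add_neg]
    rw [A1, A2, A3]
    ring
  -- conclusion
  have hz₀ : x - θ x ∈ K' := ⟨x, hx, rfl⟩
  have hd := hdbl _ hz₀ h hh hhh₀
  have hsq : (∑ i, (f (x + h • e i) + f (x - h • e i) - 2 * f x)) ^ 2 ≤ (ε * h ^ 2) ^ 2 := by
    rw [← lhs_eq]
    refine hcs.trans ?_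
    rw [rhs_eq]
    calc _ ≤ ε' * h ^ 4 * N := by
          exact mul_le_mul_of_nonneg_right ((le_abs_self _).trans hd) hN0
      _ ≤ (ε * h ^ 2) ^ 2 := by
          rw [hε']
          have : ε ^ 2 / (N + 1) * N ≤ ε ^ 2 := by
            rw [div_mul_eq_mul_div, div_le_iff₀ (by positivity)]; nlinarith [sq_nonneg ε]
          nlinarith [pow_nonneg hh.le 4]
  have := abs_le_of_sq_le_sq hsq (by positivity)
  exact this

/-! ### Separated points: translate the mirror between `u` and the cluster -/

/-- **Harmonicity at a point separated from the cluster by the mirror family of `n`** (mirror OS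
data for `n`): translate along `n` so that the mirror `n^⊥` passes strictly between `u` and `y`
(translation invariance of `S`), then apply `harmonicOnNhd_of_mirrorOSData`. -/
theorem harmonicAt_of_separated {S : CorrFamily 3} (htr : IsTranslationInvariant S)
    (hsc : IsScaleCovariant (1 / 2) S)
    (hiso : ∀ (R : E³ ≃ₗᵢ[ℝ] E³) (x : E³), x ≠ 0 → S 2 ![0, R x] = S 2 ![0, x])
    (hcont : ∀ k, ContinuousOn (S k) (NonCoincident 3 k)) {n : E³} (hOS : MirrorOSData S n)
    {m : ℕ} {y : Fin m → E³} (hy : Function.Injective y) {u : E³}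
    (hu : ∀ i, ⟪u, n⟫_ℝ < ⟪y i, n⟫_ℝ) :
    InnerProductSpace.HarmonicAt (fun x : E³ => S (m + 1) (Fin.cons x y)) u := by
  have hn : n ≠ 0 := hOS.normal_ne_zero
  -- a level strictly between
  obtain ⟨t, htu, hty⟩ : ∃ t : ℝ, ⟪u, n⟫_ℝ < t ∧ ∀ i, t < ⟪y i, n⟫_ℝ := by
    rcases isEmpty_or_nonempty (Fin m) with hm | hm
    · exact ⟨⟪u, n⟫_ℝ + 1, by linarith, fun i => hm.elim i⟩
    · obtain ⟨i₀, hi₀⟩ := Finite.exists_min fun i => ⟪y i, n⟫_ℝ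
      refine ⟨(⟪u, n⟫_ℝ + ⟪y i₀, n⟫_ℝ) / 2, by linarith [hu i₀], fun i => ?_⟩
      have := hi₀ i
      linarith [hu i₀]
  set v : E³ := (t / ‖n‖ ^ 2) • n with hv
  have hvn : ⟪v, n⟫_ℝ = t := by
    rw [hv, real_inner_smul_left, real_inner_self_eq_norm_sq]
    have : ‖n‖ ≠ 0 := norm_ne_zero_iff.2 hn
    field_simp
  have hy' : Function.Injective fun i => y i - v := fun i j h => hy (sub_left_injective h)
  have hyn' : ∀ i, 0 < ⟪y i - v, n⟫_ℝ := fun i => by rw [inner_sub_left, hvn]; linarith [hty i]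
  have hun : ⟪u - v, n⟫_ℝ < 0 := by rw [inner_sub_left, hvn]; linarith
  have hcore := harmonicOnNhd_of_mirrorOSData htr hsc hiso hcont hOS hy' hyn' (u - v) hun
  have key := harmonicAt_comp_sub_const v hcore
  refine (InnerProductSpace.harmonicAt_congr_nhds (Eventually.of_forall fun x => ?_)).1 key
  show S (m + 1) (Fin.cons (x - v) fun i => y i - v) = S (m + 1) (Fin.cons x y)
  rw [fin_cons_sub_eq]
  exact htr (m + 1) (-v) (Fin.cons x y)

end Core

/-! ### The registered stub -/

/-- **STUB 2 of line `null-laplacian-edge-gaussianity` (the lever at the edge `Δ = 1/2`).**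
Under the crux hypotheses (H1)–(H7), nine-mirror OS positivity of all orders and `Δ = 1/2`: for
every injective `y : Fin m → ℝ³`, every lattice normal `n ∈ {eᵢ, eᵢ ± eⱼ}` and every `u` with
`⟪u,n⟫ < ⟪yᵢ,n⟫ ∀ i` or `⟪yᵢ,n⟫ < ⟪u,n⟫ ∀ i`, the function `x ↦ S_{m+1}(x, y)` is harmonic at `u`.
Proof: the landed regularity of limits (`stub_limitRegularity`: hyperoctahedral invariance,
permutation symmetry, continuity, Gaussian domination) and the RP hypothesis give mirror OS data for
`n` and `-n` (`mirrorOSData_smul_latticeNormal`); the second case is the first for `-n`;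
`harmonicAt_of_separated` (discrete OS null vector at `Δ = 1/2`, Weyl's lemma) concludes.
[cite: GlimmJaffe1987, §6.1 Prop. 6.1.1; FrohlichIsraelLiebSimon1978, §2–3] -/
theorem stub_exteriorHarmonic :
    ∀ (ρ : ℝ → ℝ) (Δ : ℝ) (S : CorrFamily 3), (∀ δ ∈ Set.Ioc (0:ℝ) 1, 0 < ρ δ) →
      HasPointwiseScalingLimit (criticalCorr 3) ρ S →
      (∀ n z, z ∉ NonCoincident 3 n → S n z = 0) → IsNondegenerateTwoPoint S →
      IsTranslationInvariant S → IsScaleCovariant Δ S →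
      (∀ (R : EuclideanSpace ℝ (Fin 3) ≃ₗᵢ[ℝ] EuclideanSpace ℝ (Fin 3))
        (x : EuclideanSpace ℝ (Fin 3)), x ≠ 0 → S 2 ![0, R x] = S 2 ![0, x]) →
      (∀ n : EuclideanSpace ℝ (Fin 3),
        (∃ i j : Fin 3, i ≠ j ∧ (n = EuclideanSpace.single i 1 ∨
          n = EuclideanSpace.single i 1 + EuclideanSpace.single j 1 ∨
          n = EuclideanSpace.single i 1 - EuclideanSpace.single j 1)) →
        ∀ (k : ℕ) (m : Fin k → ℕ) (A : (a : Fin k) → Fin (m a) → EuclideanSpace ℝ (Fin 3))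
          (c : Fin k → ℝ), (∀ a i, 0 < inner ℝ (A a i) n) →
          0 ≤ ∑ a, ∑ b, c a * c b *
            S (m a + m b) (Fin.append (fun i => ((ℝ ∙ n)ᗮ).reflection (A a i)) (A b))) →
      Δ = 1 / 2 →
      ∀ (m : ℕ) (y : Fin m → EuclideanSpace ℝ (Fin 3)), Function.Injective y →
        ∀ n : EuclideanSpace ℝ (Fin 3),
          (∃ i j : Fin 3, i ≠ j ∧ (n = EuclideanSpace.single i 1 ∨
            n = EuclideanSpace.single i 1 + EuclideanSpace.single j 1 ∨
            n = EuclideanSpace.single i 1 - EuclideanSpace.single j 1)) →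
          ∀ u : EuclideanSpace ℝ (Fin 3),
            ((∀ i, inner ℝ u n < inner ℝ (y i) n) ∨ (∀ i, inner ℝ (y i) n < inner ℝ u n)) →
            InnerProductSpace.HarmonicAt
              (fun x : EuclideanSpace ℝ (Fin 3) => S (m + 1) (Fin.cons x y)) u := by
  intro ρ Δ S hρ hlim hnorm hnd htr hsc hiso hRP hΔ m y hy n hn u hu
  subst hΔ
  have hL : LimitStructure (1 / 2) S :=
    ⟨stub_limitRegularity ρ (1 / 2) S ⟨hρ, hlim, hnorm, hnd, htr, hsc⟩,
      fun n' hn' => hRP n' ((mem_latticeMirrorNormals_iff n').1 hn')⟩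
  obtain ⟨_, _, _, _, _, _, _, _, hcont⟩ := hL.1
  have hn' : n ∈ latticeMirrorNormals (Fin 3) := (mem_latticeMirrorNormals_iff n).2 hn
  rcases hu with hu | hu
  · exact harmonicAt_of_separated htr hsc hiso hcont (mirrorOSData_latticeNormal hL hn') hy hu
  · have hOS : MirrorOSData S (-n) := by
      simpa using mirrorOSData_smul_latticeNormal hL hn' (c := -1) (by norm_num)
    refine harmonicAt_of_separated htr hsc hiso hcont hOS hy fun i => ?_
    simp only [inner_neg_right]
    linarith [hu i]

end Summit.CriticalPhenomena.Ising3DConformalLimit.Cruxes.RotationUpgradeFromTwoPoint.NullLaplacianEdgeGaussianity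

end
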